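import Literature.Analysis.UnboundedOperators.HeatKernelReversePoincare
import HarnessLib

/-!
# Hamilton's logarithmic gradient estimate for bounded nonnegative caloric functions

Analysis/UnboundedOperators file (all results proved, no definitions, no named facts). For a
finite-dimensional real inner product space `E`, the Gauss–Weierstrass kernel `G_t = heatKernel t`
(`0 < t`) and a continuous `f : E → ℝ` with `0 ≤ f ≤ M`, the caloric extension
`V = (e^{tΔ}f)(x)` controls its own gradient LOGARITHMICALLY near the zero level:

  `‖∇(e^{tΔ}f)(x)‖ ≤ 2 V₀ √((1 + log (M/V₀)) / t)`   whenever `(e^{tΔ}f)(x) ≤ V₀`, `0 < V₀ ≤ M`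

(`norm_fderiv_heatExtension_le_mul_sqrt_log`). This is the Euclidean case of R. Hamilton's
gradient estimate `t ‖∇f‖² ≤ f² log (A/f)` for positive solutions `f ≤ A` of the heat equation
(Hamilton 1993, Thm. 1.1, proved there on compact manifolds by the maximum principle), with an
explicit constant, obtained here directly from the heat-kernel representation
`∂_c(e^{tΔ}f)(x) = −(2t)⁻¹ ∫ ⟪z, c⟫ G_t(z) f(x − z) dz` by a Chernoff–bathtub argument: the
weight `|⟪z, c⟫|` is at most `r` plus an exponentially small multiple of `e^{±a⟪z, c⟫}`, the
exponential moments of `G_t` are Gaussian (`∫ G_t(z) e^{⟪z, w⟫/(2t)} dz = e^{‖w‖²/(4t)}`, the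
tilted kernel is a translate), and the choice `r = 2√(t(1 + log(M/V₀)))`, `a = r/(2t)` balances
the two terms. Compared with the Li–Yau/Bernstein flatness bound
`2t ‖∇e^{tΔ}f‖² ≤ M² − (e^{tΔ}f)²` (`two_mul_mul_sq_norm_fderiv_heatExtension_le`), which gives
`‖∇‖ ≲ √(M V₀ / t)` near the zero level, the logarithmic bound gains the factor
`√(V₀/M) · √(log(M/V₀))` — the half-space (error-function) profile shows it is sharp. It is the
caloric input of the fast-set speed-gradient bound at the initial maximum level in
`Summits/NavierStokesRegularity`, route `LevelSetModeration` (item `HighSpeedPressureWork`).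

## References

* R. S. Hamilton, *A matrix Harnack estimate for the heat equation*, Comm. Anal. Geom. 1 (1993)
  113–126, Thm. 1.1. [cite: Hamilton1993Harnack, Thm. 1.1]
* L. C. Evans, *Partial Differential Equations*, 2nd ed., §2.3.1 (heat kernel). [folklore]
-/

open MeasureTheory Filter Topology Set InnerProductSpace Metric
open scoped Real RealInnerProductSpace

noncomputable section

namespace Literature.Analysis.UnboundedOperators

variable {E : Type*} [NormedAddCommGroup E] [InnerProductSpace ℝ E] [FiniteDimensional ℝ E]
  [MeasurableSpace E] [BorelSpace E]

/-! ### Exponential moments of the heat kernel -/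

omit [FiniteDimensional ℝ E] [MeasurableSpace E] [BorelSpace E] in
/-- **Exponential tilt of the heat kernel is a translate**:
`G_t(z) e^{⟪z, w⟫/(2t)} = e^{‖w‖²/(4t)} G_t(z − w)` (completing the square). [folklore] -/
theorem heatKernel_mul_exp_inner_div {t : ℝ} (ht : 0 < t) (z w : E) :
    heatKernel t z * Real.exp (⟪z, w⟫ / (2 * t)) =
      Real.exp (‖w‖ ^ 2 / (4 * t)) * heatKernel t (z - w) := by
  have h4 : (4 * t) ≠ 0 := by positivity
  have key : -‖z‖ ^ 2 / (4 * t) + ⟪z, w⟫ / (2 * t) =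
      ‖w‖ ^ 2 / (4 * t) + -‖z - w‖ ^ 2 / (4 * t) := by
    rw [@norm_sub_sq ℝ]
    simp only [RCLike.re_to_real]
    field_simp
    ring
  simp only [heatKernel]
  rw [mul_assoc, ← Real.exp_add, key, Real.exp_add]
  ring

/-- **Gaussian exponential moment**: `∫ G_t(z) e^{⟪z, w⟫/(2t)} dz = e^{‖w‖²/(4t)}` for `0 < t`.
[folklore] -/
theorem integral_heatKernel_mul_exp_inner_div {t : ℝ} (ht : 0 < t) (w : E) :
    ∫ z, heatKernel t z * Real.exp (⟪z, w⟫ / (2 * t)) = Real.exp (‖w‖ ^ 2 / (4 * t)) := by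
  simp_rw [heatKernel_mul_exp_inner_div ht]
  rw [integral_const_mul, integral_sub_right_eq_self (heatKernel t) w,
    integral_heatKernel_eq_one_holds ht, mul_one]

/-- The tilted kernel `z ↦ G_t(z) e^{⟪z, w⟫/(2t)}` is integrable (`0 < t`). [folklore] -/
theorem integrable_heatKernel_mul_exp_inner_div {t : ℝ} (ht : 0 < t) (w : E) :
    Integrable (fun z : E => heatKernel t z * Real.exp (⟪z, w⟫ / (2 * t))) := by
  simp_rw [heatKernel_mul_exp_inner_div ht]
  exact ((integrable_heatKernel_holds ht).comp_sub_right w).const_mul _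

/-! ### The Chernoff–bathtub inequality for the first moment -/

/-- **Chernoff bound for the absolute value**: for `a > 0` and all real `r, s`,
`|s| ≤ r + (e^{a s} + e^{-a s}) e^{-a r - 1}/a` (from `y ≤ e^{y-1}` with `y = a(|s| − r)` and
`e^{a|s|} ≤ e^{as} + e^{-as}`). [folklore] -/
theorem abs_le_add_exp_mul {a : ℝ} (ha : 0 < a) (r s : ℝ) :
    |s| ≤ r + (Real.exp (a * s) + Real.exp (-(a * s))) * (Real.exp (-(a * r) - 1) / a) := by
  have hy : a * (|s| - r) ≤ Real.exp (a * (|s| - r) - 1) := by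
    have := Real.add_one_le_exp (a * (|s| - r) - 1)
    linarith
  have hexp : Real.exp (a * |s|) ≤ Real.exp (a * s) + Real.exp (-(a * s)) := by
    rcases abs_choice s with h | h
    · rw [h]; linarith [Real.exp_pos (-(a * s))]
    · rw [h, mul_neg]; linarith [Real.exp_pos (a * s)]
  have hsplit : Real.exp (a * (|s| - r) - 1) = Real.exp (a * |s|) * Real.exp (-(a * r) - 1) := by
    rw [← Real.exp_add]; congr 1; ring
  have h1 : |s| - r ≤ Real.exp (a * |s|) * Real.exp (-(a * r) - 1) / a := by
    rw [le_div_iff₀ ha, ← hsplit]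
    linarith
  have h2 : Real.exp (a * |s|) * Real.exp (-(a * r) - 1) / a ≤
      (Real.exp (a * s) + Real.exp (-(a * s))) * (Real.exp (-(a * r) - 1) / a) := by
    rw [mul_div_assoc]
    exact mul_le_mul_of_nonneg_right hexp (by positivity)
  linarith

/-! ### Hamilton's logarithmic gradient estimate -/

/-- The weighted first moment of nonnegative data below a caloric value: for continuous
`0 ≤ f ≤ M`, `0 < t`, a unit vector `c`, and parameters `a > 0`, `r ∈ ℝ`,
`∫ |⟪z, c⟫| G_t(z) f(x − z) dz ≤ r (e^{tΔ}f)(x) + 2 M e^{a² t} e^{-a r - 1}/a`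
(bathtub split of the weight, `abs_le_add_exp_mul`, and the Gaussian exponential moments).
[folklore] -/
theorem integral_abs_inner_mul_heatKernel_mul_le {f : E → ℝ} (hf : Continuous f) {M : ℝ}
    (hf0 : ∀ z, 0 ≤ f z) (hfM : ∀ z, f z ≤ M) {t : ℝ} (ht : 0 < t) (x : E) {c : E}
    (hc : ‖c‖ = 1) {a : ℝ} (ha : 0 < a) (r : ℝ) :
    ∫ z, |⟪z, c⟫| * heatKernel t z * f (x - z) ≤
      r * heatExtension f t x +
        2 * M * Real.exp (a ^ 2 * t) * (Real.exp (-(a * r) - 1) / a) := by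
  have hM0 : 0 ≤ M := (hf0 0).trans (hfM 0)
  have hK := integrable_heatKernel_holds (E := E) ht
  have hfb : ∀ z, ‖f z‖ ≤ M := fun z => by
    rw [Real.norm_of_nonneg (hf0 z)]; exact hfM z
  -- the pieces and their integrability
  set w : E := (2 * t * a) • c with hw
  have hinner : ∀ z : E, ⟪z, w⟫ / (2 * t) = a * ⟪z, c⟫ := fun z => by
    rw [hw, real_inner_smul_right]
    field_simp
  have hinner' : ∀ z : E, ⟪z, -w⟫ / (2 * t) = -(a * ⟪z, c⟫) := fun z => by
    rw [inner_neg_right, neg_div, hinner]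
  have hw2 : ‖w‖ ^ 2 / (4 * t) = a ^ 2 * t := by
    rw [hw, norm_smul, hc, mul_one, Real.norm_of_nonneg (by positivity)]
    field_simp
    ring
  have hw2' : ‖-w‖ ^ 2 / (4 * t) = a ^ 2 * t := by rw [norm_neg, hw2]
  have iGf : Integrable fun z => heatKernel t z * f (x - z) := by
    have := integrable_heatKernel_smul_of_bound (F := ℝ) hf hfb ht x
    simpa only [smul_eq_mul] using this
  have hfc : Continuous fun z => f (x - z) := hf.comp (continuous_const.sub continuous_id)
  have iEp : Integrable fun z => heatKernel t z * Real.exp (a * ⟪z, c⟫) * f (x - z) := by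
    have h1 : Integrable fun z : E => heatKernel t z * Real.exp (⟪z, w⟫ / (2 * t)) :=
      integrable_heatKernel_mul_exp_inner_div ht w
    refine ((h1.mul_const M).mono' ?_ (Eventually.of_forall fun z => ?_))
    · exact (((continuous_heatKernel t).mul
        (Real.continuous_exp.comp (continuous_const.mul (continuous_id.inner continuous_const)))).mul
          hfc).aestronglyMeasurable
    · rw [hinner, Real.norm_of_nonneg (by
        exact mul_nonneg (mul_nonneg (heatKernel_pos ht z).le (Real.exp_pos _).le) (hf0 _))]
      exact mul_le_mul_of_nonneg_left (hfM _)
        (mul_nonneg (heatKernel_pos ht z).le (Real.exp_pos _).le)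
  have iEm : Integrable fun z => heatKernel t z * Real.exp (-(a * ⟪z, c⟫)) * f (x - z) := by
    have h1 : Integrable fun z : E => heatKernel t z * Real.exp (⟪z, -w⟫ / (2 * t)) :=
      integrable_heatKernel_mul_exp_inner_div ht (-w)
    refine ((h1.mul_const M).mono' ?_ (Eventually.of_forall fun z => ?_))
    · exact (((continuous_heatKernel t).mul
        (Real.continuous_exp.comp
          ((continuous_const.mul (continuous_id.inner continuous_const)).neg))).mul
          hfc).aestronglyMeasurable
    · rw [hinner', Real.norm_of_nonneg (by
        exact mul_nonneg (mul_nonneg (heatKernel_pos ht z).le (Real.exp_pos _).le) (hf0 _))]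
      exact mul_le_mul_of_nonneg_left (hfM _)
        (mul_nonneg (heatKernel_pos ht z).le (Real.exp_pos _).le)
  set κ : ℝ := Real.exp (-(a * r) - 1) / a with hκ
  have hκ0 : 0 ≤ κ := by rw [hκ]; positivity
  -- pointwise bathtub bound of the integrand
  have hpt : ∀ z : E, |⟪z, c⟫| * heatKernel t z * f (x - z) ≤
      r * (heatKernel t z * f (x - z)) +
        κ * (heatKernel t z * Real.exp (a * ⟪z, c⟫) * f (x - z) +
          heatKernel t z * Real.exp (-(a * ⟪z, c⟫)) * f (x - z)) := by
    intro z
    have hGf : 0 ≤ heatKernel t z * f (x - z) := mul_nonneg (heatKernel_pos ht z).le (hf0 _)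
    have hb := abs_le_add_exp_mul ha r ⟪z, c⟫
    calc |⟪z, c⟫| * heatKernel t z * f (x - z) = |⟪z, c⟫| * (heatKernel t z * f (x - z)) := by
          ring
      _ ≤ (r + (Real.exp (a * ⟪z, c⟫) + Real.exp (-(a * ⟪z, c⟫))) * κ) *
            (heatKernel t z * f (x - z)) := mul_le_mul_of_nonneg_right hb hGf
      _ = _ := by ring
  -- integrate
  have iL : Integrable fun z => |⟪z, c⟫| * heatKernel t z * f (x - z) := by
    refine (((integrable_heatKernel_mul_norm (E := E) ht).mul_const M).mono' ?_
      (Eventually.of_forall fun z => ?_))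
    · exact (((continuous_id.inner continuous_const).abs.mul (continuous_heatKernel t)).mul
        hfc).aestronglyMeasurable
    · rw [Real.norm_of_nonneg (mul_nonneg (mul_nonneg (abs_nonneg _) (heatKernel_pos ht z).le)
        (hf0 _))]
      have h1 : |⟪z, c⟫| ≤ ‖z‖ := by
        have := abs_real_inner_le_norm z c
        rwa [hc, mul_one] at this
      calc |⟪z, c⟫| * heatKernel t z * f (x - z) ≤ ‖z‖ * heatKernel t z * M :=
            mul_le_mul (mul_le_mul_of_nonneg_right h1 (heatKernel_pos ht z).le) (hfM _) (hf0 _)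
              (mul_nonneg (norm_nonneg _) (heatKernel_pos ht z).le)
        _ = heatKernel t z * ‖z‖ * M := by ring
  have iS : Integrable fun z => heatKernel t z * Real.exp (a * ⟪z, c⟫) * f (x - z) +
      heatKernel t z * Real.exp (-(a * ⟪z, c⟫)) * f (x - z) := iEp.add iEm
  have iR : Integrable fun z => r * (heatKernel t z * f (x - z)) +
      κ * (heatKernel t z * Real.exp (a * ⟪z, c⟫) * f (x - z) +
        heatKernel t z * Real.exp (-(a * ⟪z, c⟫)) * f (x - z)) :=
    (iGf.const_mul r).add (iS.const_mul κ)
  have hmono := integral_mono iL iR hpt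
  rw [integral_add (iGf.const_mul r) (iS.const_mul κ), integral_const_mul,
    integral_const_mul, integral_add iEp iEm] at hmono
  -- the value `e^{tΔ}f(x)`
  have hV : ∫ z, heatKernel t z * f (x - z) = heatExtension f t x := by
    rw [heatExtension_apply]; rfl
  -- the exponential moments, bounded by `M e^{a²t}`
  have hEp : ∫ z, heatKernel t z * Real.exp (a * ⟪z, c⟫) * f (x - z) ≤ M * Real.exp (a ^ 2 * t) := by
    have h1 : ∫ z, heatKernel t z * Real.exp (a * ⟪z, c⟫) * f (x - z) ≤
        ∫ z, heatKernel t z * Real.exp (⟪z, w⟫ / (2 * t)) * M := by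
      refine integral_mono iEp ((integrable_heatKernel_mul_exp_inner_div ht w).mul_const M)
        fun z => ?_
      dsimp only
      rw [hinner]
      exact mul_le_mul_of_nonneg_left (hfM _)
        (mul_nonneg (heatKernel_pos ht z).le (Real.exp_pos _).le)
    rw [integral_mul_const, integral_heatKernel_mul_exp_inner_div ht w, hw2] at h1
    linarith
  have hEm : ∫ z, heatKernel t z * Real.exp (-(a * ⟪z, c⟫)) * f (x - z) ≤
      M * Real.exp (a ^ 2 * t) := by
    have h1 : ∫ z, heatKernel t z * Real.exp (-(a * ⟪z, c⟫)) * f (x - z) ≤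
        ∫ z, heatKernel t z * Real.exp (⟪z, -w⟫ / (2 * t)) * M := by
      refine integral_mono iEm ((integrable_heatKernel_mul_exp_inner_div ht (-w)).mul_const M)
        fun z => ?_
      dsimp only
      rw [hinner']
      exact mul_le_mul_of_nonneg_left (hfM _)
        (mul_nonneg (heatKernel_pos ht z).le (Real.exp_pos _).le)
    rw [integral_mul_const, integral_heatKernel_mul_exp_inner_div ht (-w), hw2'] at h1
    linarith
  rw [hV] at hmono
  have hsum : κ * ((∫ z, heatKernel t z * Real.exp (a * ⟪z, c⟫) * f (x - z)) +
      ∫ z, heatKernel t z * Real.exp (-(a * ⟪z, c⟫)) * f (x - z)) ≤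
        κ * (2 * (M * Real.exp (a ^ 2 * t))) :=
    mul_le_mul_of_nonneg_left (by linarith) hκ0
  calc ∫ z, |⟪z, c⟫| * heatKernel t z * f (x - z)
      ≤ r * heatExtension f t x + κ * ((∫ z, heatKernel t z * Real.exp (a * ⟪z, c⟫) * f (x - z)) +
          ∫ z, heatKernel t z * Real.exp (-(a * ⟪z, c⟫)) * f (x - z)) := hmono
    _ ≤ r * heatExtension f t x + κ * (2 * (M * Real.exp (a ^ 2 * t))) := by linarith
    _ = _ := by rw [hκ]; ring

/-- **Hamilton's logarithmic gradient estimate (Euclidean caloric extension).** For continuous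
`f : E → ℝ` with `0 ≤ f ≤ M`, `0 < t`, `x ∈ E`, and any `V₀` with `(e^{tΔ}f)(x) ≤ V₀`,
`0 < V₀ ≤ M`:

  `‖∇(e^{tΔ}f)(x)‖ ≤ 2 V₀ √((1 + log (M/V₀)) / t)`.

Near the zero level this is `‖∇ e^{tΔ}f‖ ≲ V₀ √(log(M/V₀)/t)`, Hamilton's
`t ‖∇f‖² ≤ f² log(A/f)` (Thm. 1.1) up to the constant; the monotone-majorant form (`V₀` in place
of the value) is the one used in applications. Proof: the gradient formula
`fderiv_heatExtension_apply_eq_integral_inner`, the bathtub bound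
`integral_abs_inner_mul_heatKernel_mul_le` with `r = 2√(t L)`, `a = √(L/t)`, `L = 1 + log(M/V₀)`.
[cite: Hamilton1993Harnack, Thm. 1.1] -/
theorem norm_fderiv_heatExtension_le_mul_sqrt_log {f : E → ℝ} (hf : Continuous f) {M : ℝ}
    (hf0 : ∀ z, 0 ≤ f z) (hfM : ∀ z, f z ≤ M) {t : ℝ} (ht : 0 < t) (x : E) {V₀ : ℝ}
    (hV₀ : 0 < V₀) (hV₀M : V₀ ≤ M) (hle : heatExtension f t x ≤ V₀) :
    ‖fderiv ℝ (heatExtension f t) x‖ ≤ 2 * V₀ * Real.sqrt ((1 + Real.log (M / V₀)) / t) := by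
  have hM : 0 < M := hV₀.trans_le hV₀M
  have hfb : ∀ z, ‖f z‖ ≤ M := fun z => by
    rw [Real.norm_of_nonneg (hf0 z)]; exact hfM z
  set L : ℝ := 1 + Real.log (M / V₀) with hL
  have hlog : 0 ≤ Real.log (M / V₀) := Real.log_nonneg ((one_le_div hV₀).2 hV₀M)
  have hL1 : 1 ≤ L := by rw [hL]; linarith
  have hL0 : 0 < L := by linarith
  -- parameters `a = √(L/t)`, `r = 2 t a`
  set a : ℝ := Real.sqrt (L / t) with ha
  have ha0 : 0 < a := by rw [ha]; exact Real.sqrt_pos.2 (div_pos hL0 ht)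
  have ha2' : a ^ 2 = L / t := by rw [ha, Real.sq_sqrt (div_pos hL0 ht).le]
  have ha2 : a ^ 2 * t = L := by rw [ha2']; field_simp
  set r : ℝ := 2 * t * a with hr
  have hr0 : 0 ≤ r := by rw [hr]; positivity
  have har : a * r = 2 * L := by
    rw [hr]
    calc a * (2 * t * a) = 2 * (a ^ 2 * t) := by ring
      _ = 2 * L := by rw [ha2]
  -- the exponentially small factor
  have hκ : 2 * M * Real.exp (a ^ 2 * t) * (Real.exp (-(a * r) - 1) / a) =
      2 * V₀ * Real.exp (-2) / a := by
    rw [ha2, har]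
    have h1 : Real.exp L * Real.exp (-(2 * L) - 1) = Real.exp (-L - 1) := by
      rw [← Real.exp_add]; congr 1; ring
    have h2 : Real.exp (-L - 1) = V₀ / M * Real.exp (-2) := by
      have : -L - 1 = -Real.log (M / V₀) + (-2) := by rw [hL]; ring
      rw [this, Real.exp_add, Real.exp_neg, Real.exp_log (div_pos hM hV₀), inv_div]
    calc 2 * M * Real.exp L * (Real.exp (-(2 * L) - 1) / a)
        = 2 * M * (Real.exp L * Real.exp (-(2 * L) - 1)) / a := by ring
      _ = 2 * M * (V₀ / M * Real.exp (-2)) / a := by rw [h1, h2]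
      _ = 2 * V₀ * Real.exp (-2) / a := by field_simp
  -- `1/(t a) ≤ a` (i.e. `1 ≤ t a² = L`) and `e^{-2} ≤ 1`
  have hta : 1 / (t * a) ≤ a := by
    rw [div_le_iff₀ (mul_pos ht ha0)]
    calc (1 : ℝ) ≤ L := hL1
      _ = a * (t * a) := by rw [← ha2]; ring
  have he2 : Real.exp (-2) ≤ 1 := Real.exp_le_one_iff.2 (by norm_num)
  -- directional bound for unit vectors
  have hdir : ∀ c : E, ‖c‖ = 1 → |fderiv ℝ (heatExtension f t) x c| ≤ 2 * V₀ * a := by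
    intro c hc
    rw [fderiv_heatExtension_apply_eq_integral_inner hf hfb ht x c, abs_mul, abs_neg,
      abs_of_pos (by positivity : (0 : ℝ) < 1 / (2 * t))]
    have hI := integral_abs_inner_mul_heatKernel_mul_le hf hf0 hfM ht x hc ha0 r
    have habs : |∫ z, ⟪z, c⟫ * heatKernel t z * f (x - z)| ≤
        ∫ z, |⟪z, c⟫| * heatKernel t z * f (x - z) := by
      refine (abs_integral_le_integral_abs).trans (le_of_eq ?_)
      refine integral_congr_ae (Eventually.of_forall fun z => ?_)
      dsimp only
      rw [abs_mul, abs_mul, abs_of_pos (heatKernel_pos ht z), abs_of_nonneg (hf0 _)]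
    have hmain : ∫ z, |⟪z, c⟫| * heatKernel t z * f (x - z) ≤
        r * V₀ + 2 * V₀ * Real.exp (-2) / a := by
      rw [← hκ]
      refine hI.trans ?_
      have : r * heatExtension f t x ≤ r * V₀ := mul_le_mul_of_nonneg_left hle hr0
      linarith
    -- `(1/(2t)) (r V₀ + 2 V₀ e^{-2}/a) = a V₀ + V₀ e^{-2} (1/(t a)) ≤ 2 a V₀`
    have hsecond : V₀ * Real.exp (-2) * (1 / (t * a)) ≤ V₀ * a := by
      calc V₀ * Real.exp (-2) * (1 / (t * a)) ≤ V₀ * 1 * a := by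
            gcongr
          _ = V₀ * a := by ring
    calc 1 / (2 * t) * |∫ z, ⟪z, c⟫ * heatKernel t z * f (x - z)|
        ≤ 1 / (2 * t) * (r * V₀ + 2 * V₀ * Real.exp (-2) / a) :=
          mul_le_mul_of_nonneg_left (habs.trans hmain) (by positivity)
      _ = a * V₀ + V₀ * Real.exp (-2) * (1 / (t * a)) := by
          rw [hr]; field_simp
      _ ≤ a * V₀ + V₀ * a := by linarith
      _ = 2 * V₀ * a := by ring
  -- operator norm from the directional bounds
  have hK0 : 0 ≤ 2 * V₀ * a := by positivity
  have hop : ‖fderiv ℝ (heatExtension f t) x‖ ≤ 2 * V₀ * a := by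
    refine ContinuousLinearMap.opNorm_le_bound _ hK0 fun c => ?_
    by_cases hc : c = 0
    · simp [hc]
    · have hcn : 0 < ‖c‖ := norm_pos_iff.2 hc
      set e : E := ‖c‖⁻¹ • c with he
      have hen : ‖e‖ = 1 := by
        rw [he, norm_smul, norm_inv, norm_norm, inv_mul_cancel₀ hcn.ne']
      have hce : c = ‖c‖ • e := by
        rw [he, smul_smul, mul_inv_cancel₀ hcn.ne', one_smul]
      have h1 := hdir e hen
      calc ‖fderiv ℝ (heatExtension f t) x c‖ = ‖c‖ * |fderiv ℝ (heatExtension f t) x e| := by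
            conv_lhs => rw [hce]
            rw [ContinuousLinearMap.map_smul, smul_eq_mul, norm_mul, norm_norm, Real.norm_eq_abs]
        _ ≤ ‖c‖ * (2 * V₀ * a) := mul_le_mul_of_nonneg_left h1 hcn.le
        _ = 2 * V₀ * a * ‖c‖ := by ring
  rw [ha, hL] at hop
  exact hop

end Literature.Analysis.UnboundedOperators

end
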